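import Summits.AnomalousDissipation.AnomalousDissipation.Theorems.SolenoidalFractalHomogenisationLagrangianStepOneLevelGlue
import Summits.AnomalousDissipation.AnomalousDissipation.Theorems.SolenoidalFractalHomogenisationRealisedQuasiStaticCellLawSingleMode
import Literature.Analysis.FluidPDE.PassiveVectorTensorLionsExistence
import HarnessLib

/-!
# K1L `LagrangianRenormalisationStep` (stmt-AnomalousDissipation-24912) — finding F-p4g7-3: the EXISTENCE sub-conjunct of the slow-vector clause (V)
# inside `stub_cellLawV` is provable now

Planner `ad-ideate-p4` g7, 2026-08-28.  Sorry-free.  Companion of F-p4g7-2 (`ExistsRenormSketch.lean`).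

`stub_cellLawV` (XL; v18/v19 text) concludes `… WindowClause Φ lo hi Λ β ∧ … ∧ SlowVectorClause W M hM c Φ lo hi Λ β σ C ν₀ K`, and
`SlowVectorClause` (landed defs p613864) carries, for every cell viscosity / size / window tensor / slow mode / polarisation / horizon, the
conjunct `(∃ v, IsWeakTensorPassiveVectorOn 0 (2T) ((1/n²)•(𝔸 + (c/ν)•Φ((1/ν)•𝔸))) 0 (Re e_ℓ • p) v) ∧ (comparison)`.  That existence is
J.-L. Lions' theorem for the CARRIER-FREE tensor problem, in the Literature as `Torus.exists_isWeakTensorPassiveVectorOn_zero_carrier`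
(PassiveVectorTensorLionsExistence.lean, Amendment 1 of 2026-08-28 — «the shape of the existence conjunct of the slow-vector clause of the K1L
cell package»), once the effective tensor is `NearIso` with a positive lower constant — which the WINDOW CLAUSE gives (this file,
`nearIso_effTensor`: `(1/n²)(ν + c/ν)·lo/λ`, `n ≥ 1` being forced by `ℓ ≠ 0` and `‖ℓ‖⌈K/ν⌉ ≤ n`), with the single-mode datum facts of K2R
(`memSobolev_one_singleMode`, `isWeaklyDivFree_singleMode`, p6079xx).  Hence a Floquet–Bloch prover of `stub_cellLawV` need not touch Lions'
machinery:

* `SlowVectorClauseNoEx` — `SlowVectorClause` VERBATIM with the existence conjunct deleted (local def; would join OneLevelDefs' sibling file);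
* `nearIso_effTensor`, `exists_effective_singleMode` — window ⇒ ellipticity of the effective tensor ⇒ existence from the single-mode datum;
* `slowVectorClause_of_noEx` — `0 < c → 0 < lo → 1 ≤ Λ… → 0 < K → WindowClause Φ lo hi Λ β → SlowVectorClauseNoEx … → SlowVectorClause …`;
* `cellLawV_of_cellLawVNoEx` — the ADAPTER: the proposed v20 statement of `stub_cellLawV` (conclusion with `SlowVectorClauseNoEx`) implies the
  registered one; composition change = one token (`stub_cellLawV` ↦ `(cellLawV_of_cellLawVNoEx stub_cellLawV)`).

A weakening (registered ⇒ proposed by dropping a conjunct); zero cost; `stub_oneLevelL` keeps RECEIVING the full `SlowVectorClause`.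
-/

set_option linter.dupNamespace false
set_option linter.unusedVariables false

namespace Summit.AnomalousDissipation.AnomalousDissipation.Cruxes.LagrangianRenormalisationStep.CellLawVNoEx

open Set Filter MeasureTheory Function
open scoped ENNReal NNReal InnerProductSpace
open Literature.Analysis Literature.Analysis.FunctionSpaces Literature.Analysis.FunctionSpaces.Torus
open Literature.Analysis.FluidPDE Literature.Analysis.FluidPDE.LatticeShear
open Summit.AnomalousDissipation.AnomalousDissipation.Theorems.SolenoidalFractalHomogenisation.RealisedQuasiStaticCellLaw
  (memLp_two_of_memSobolev_one_complexify memSobolev_one_singleMode isWeaklyDivFree_singleMode)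
open Summit.AnomalousDissipation.AnomalousDissipation.Theorems.SolenoidalFractalHomogenisation.LagrangianStep

noncomputable section

/-- The SLOW-VECTOR clause WITHOUT its existence conjunct (`SlowVectorClause` verbatim otherwise). -/
def SlowVectorClauseNoEx {k : ℕ} (W : LatticeShear.LatticeWord k) (M : ℝ) (hM : 0 < M) (c : ℝ)
    (Φ : Torus.Visc4 (Fin 3) → Torus.Visc4 (Fin 3)) (lo hi Λ β σ C ν₀ K : ℝ) : Prop :=
      ∀ ν, ∀ hν : ν ∈ Set.Ioo 0 ν₀, ∀ n : ℕ, ∀ 𝔸 : Torus.Visc4 (Fin 3),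
        Torus.OddSmall 𝔸 (ν * β) → (∃ lam ∈ Set.Icc (1:ℝ) Λ, Torus.NearIso 𝔸 (ν * (lo / lam)) (ν * (hi * lam))) →
        ∀ ℓ : Fin 3 → ℤ, ℓ ≠ 0 → ‖Torus.latticeVec ℓ‖ * (⌈K / ν⌉₊ : ℝ) ≤ n →
        ∀ p : EuclideanSpace ℝ (Fin 3), ‖p‖ = 1 → ⟪p, Torus.latticeVec ℓ⟫_ℝ = 0 →
        ∀ T > (0:ℝ),
          ∀ w v : ℝ → VF,
            Torus.IsWeakTensorPassiveVectorOn 0 T ((1 / (n:ℝ) ^ 2) • 𝔸) (cellField W M hM ν hν.1 n) (fun x => (UnitAddTorus.mFourier ℓ x).re • p) w →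
            Torus.IsWeakTensorPassiveVectorOn 0 (2 * T) ((1 / (n:ℝ) ^ 2) • (𝔸 + (c / ν) • Φ ((1 / ν) • 𝔸))) (fun _ _ => 0)
                (fun x => (UnitAddTorus.mFourier ℓ x).re • p) v →
            ∀ᵐ t ∂(volume.restrict (Ioo 0 T)),
              2 * ∑ i, ‖modeCoeff ℓ (fun x => w t x - v t x) i‖ ^ 2
                  ≤ (C * (C * (ν ^ σ + (‖Torus.latticeVec ℓ‖ * (⌈K / ν⌉₊ : ℝ) / n) ^ σ) * min 1 ((8 * Real.pi ^ 2 * ‖Torus.latticeVec ℓ‖ ^ 2 * (hi * Λ) * (ν + c / ν) / (n:ℝ) ^ 2) * t) + (8 * Real.pi ^ 2 * ‖Torus.latticeVec ℓ‖ ^ 2 * (hi * Λ) * (ν + c / ν) / (n:ℝ) ^ 2) * (M * W.period / ν))) ^ 2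
                      * ∫ x, ‖(UnitAddTorus.mFourier ℓ x).re • p‖ ^ 2

/-- A non-zero lattice vector has positive norm. [folklore] -/
theorem norm_latticeVec_pos {ℓ : Fin 3 → ℤ} (hℓ : ℓ ≠ 0) : 0 < ‖Torus.latticeVec ℓ‖ := by
  refine norm_pos_iff.2 fun h => hℓ ?_
  funext i
  have hi := congrArg (fun v : EuclideanSpace ℝ (Fin 3) => v i) h
  simp only [Torus.latticeVec_apply, PiLp.zero_apply] at hi
  exact_mod_cast hi

/-- `ℓ ≠ 0` and the slow-band condition `‖ℓ‖·⌈K/ν⌉ ≤ n` (`K, ν > 0`) force `1 ≤ n`. -/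
theorem one_le_of_slowBand {ℓ : Fin 3 → ℤ} (hℓ : ℓ ≠ 0) {K ν : ℝ} (hK : 0 < K) (hν : 0 < ν) {n : ℕ}
    (h : ‖Torus.latticeVec ℓ‖ * (⌈K / ν⌉₊ : ℝ) ≤ n) : 1 ≤ (n:ℝ) := by
  have h1 : (1:ℝ) ≤ ⌈K / ν⌉₊ := by exact_mod_cast Nat.one_le_iff_ne_zero.mpr (Nat.pos_iff_ne_zero.mp (Nat.ceil_pos.mpr (div_pos hK hν)))
  have h2 : 0 < ‖Torus.latticeVec ℓ‖ := norm_latticeVec_pos hℓ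
  -- `‖latticeVec ℓ‖ ≥ 1` for a non-zero integer vector: some coordinate has `|ℓ i| ≥ 1`
  have h3 : (1:ℝ) ≤ ‖Torus.latticeVec ℓ‖ := by
    obtain ⟨i, hi⟩ : ∃ i, ℓ i ≠ 0 := by
      by_contra hc
      push Not at hc
      exact hℓ (funext hc)
    have hcoord : |(Torus.latticeVec ℓ) i| ≤ ‖Torus.latticeVec ℓ‖ := by
      have := EuclideanSpace.norm_eq (Torus.latticeVec ℓ)
      calc |(Torus.latticeVec ℓ) i| = Real.sqrt (|(Torus.latticeVec ℓ) i| ^ 2) := by rw [Real.sqrt_sq (abs_nonneg _)]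
        _ ≤ Real.sqrt (∑ j, ‖(Torus.latticeVec ℓ) j‖ ^ 2) := by
            apply Real.sqrt_le_sqrt
            rw [← Real.norm_eq_abs]
            exact Finset.single_le_sum (f := fun j => ‖(Torus.latticeVec ℓ) j‖ ^ 2) (fun j _ => sq_nonneg _) (Finset.mem_univ i)
        _ = ‖Torus.latticeVec ℓ‖ := this.symm
    have h1i : (1:ℝ) ≤ |(Torus.latticeVec ℓ) i| := by
      rw [Torus.latticeVec_apply]
      have hz : ((1:ℤ) : ℝ) ≤ ((|ℓ i| : ℤ) : ℝ) := by exact_mod_cast Int.one_le_abs hi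
      simpa [Int.cast_abs] using hz
    exact h1i.trans hcoord
  nlinarith

/-- **Ellipticity of the effective tensor from the window clause.**  For `𝔸` in the `ν`-scaled nested window and `n ≥ 1`, the effective cell
tensor `(1/n²)•(𝔸 + (c/ν)•Φ((1/ν)•𝔸))` is `NearIso` with the positive lower constant `(1/n²)·(ν + c/ν)·(lo/λ)`. -/
theorem nearIso_effTensor {Φ : FluidPDE.Torus.Visc4 (Fin 3) → FluidPDE.Torus.Visc4 (Fin 3)} {lo hi Λ β : ℝ}
    (hwin : WindowClause Φ lo hi Λ β) {ν c : ℝ} (hν : 0 < ν) (hc : 0 ≤ c) {n : ℕ}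
    {𝔸 : FluidPDE.Torus.Visc4 (Fin 3)} (hodd : FluidPDE.Torus.OddSmall 𝔸 (ν * β))
    {lam : ℝ} (hlam : lam ∈ Set.Icc (1:ℝ) Λ) (hA : FluidPDE.Torus.NearIso 𝔸 (ν * (lo / lam)) (ν * (hi * lam))) :
    FluidPDE.Torus.NearIso ((1 / (n:ℝ) ^ 2) • (𝔸 + (c / ν) • Φ ((1 / ν) • 𝔸)))
      ((1 / (n:ℝ) ^ 2) * ((ν + c / ν) * (lo / lam))) ((1 / (n:ℝ) ^ 2) * ((ν + c / ν) * (hi * lam))) := by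
  have hν0 : ν ≠ 0 := hν.ne'
  -- the rescaled tensor `(1/ν)•𝔸` is in the unscaled window
  have hodd' : FluidPDE.Torus.OddSmall ((1 / ν) • 𝔸) β := by
    have h := hodd.smul (1 / ν)
    exact oddSmall_congr h (by field_simp)
  have hA' : FluidPDE.Torus.NearIso ((1 / ν) • 𝔸) (lo / lam) (hi * lam) := by
    have h := hA.smul (c := 1 / ν) (by positivity)
    exact nearIso_congr h (by field_simp) (by field_simp)
  obtain ⟨_, hΦ⟩ := hwin lam hlam ((1 / ν) • 𝔸) hodd' hA'
  have hcν : 0 ≤ c / ν := div_nonneg hc hν.le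
  have hsum := hA.add (hΦ.smul hcν)
  have hn : (0:ℝ) ≤ 1 / (n:ℝ) ^ 2 := by positivity
  have h := hsum.smul hn
  exact nearIso_congr h (by ring) (by ring)

/-- **Existence of the effective single-mode solution** (the deleted conjunct), from the window clause and Lions' carrier-free theorem.
[cite: LionsMagenes1972, Chap. 3 Thm. 1.1] -/
theorem exists_effective_singleMode {Φ : FluidPDE.Torus.Visc4 (Fin 3) → FluidPDE.Torus.Visc4 (Fin 3)} {lo hi Λ β : ℝ}
    (hlo : 0 < lo) (hwin : WindowClause Φ lo hi Λ β) {ν c K : ℝ} (hν : 0 < ν) (hc : 0 ≤ c) (hK : 0 < K) {n : ℕ}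
    {𝔸 : FluidPDE.Torus.Visc4 (Fin 3)} (hodd : FluidPDE.Torus.OddSmall 𝔸 (ν * β))
    (hwin' : ∃ lam ∈ Set.Icc (1:ℝ) Λ, FluidPDE.Torus.NearIso 𝔸 (ν * (lo / lam)) (ν * (hi * lam)))
    {ℓ : Fin 3 → ℤ} (hℓ : ℓ ≠ 0) (hsep : ‖Torus.latticeVec ℓ‖ * (⌈K / ν⌉₊ : ℝ) ≤ n)
    {p : EuclideanSpace ℝ (Fin 3)} (hperp : ⟪p, Torus.latticeVec ℓ⟫_ℝ = 0) {T : ℝ} (hT : 0 < T) :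
    ∃ v : ℝ → VF, FluidPDE.Torus.IsWeakTensorPassiveVectorOn 0 (2 * T) ((1 / (n:ℝ) ^ 2) • (𝔸 + (c / ν) • Φ ((1 / ν) • 𝔸))) (fun _ _ => 0)
      (fun x => (UnitAddTorus.mFourier ℓ x).re • p) v := by
  obtain ⟨lam, hlam, hA⟩ := hwin'
  have hN := nearIso_effTensor (n := n) hwin hν hc hodd hlam hA
  have hn1 : 1 ≤ (n:ℝ) := one_le_of_slowBand hℓ hK hν hsep
  have hlam1 : 0 < lam := lt_of_lt_of_le one_pos hlam.1
  have hlo' : 0 < (1 / (n:ℝ) ^ 2) * ((ν + c / ν) * (lo / lam)) := by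
    have : 0 < ν + c / ν := by positivity
    positivity
  exact FluidPDE.Torus.exists_isWeakTensorPassiveVectorOn_zero_carrier (by linarith) hN hlo'
    (memLp_two_of_memSobolev_one_complexify (memSobolev_one_singleMode ℓ p)) (isWeaklyDivFree_singleMode ℓ hperp)

/-- **(V) without existence ⇒ (V).** -/
theorem slowVectorClause_of_noEx {k : ℕ} {W : LatticeWord k} {M : ℝ} {hM : 0 < M} {c : ℝ}
    {Φ : FluidPDE.Torus.Visc4 (Fin 3) → FluidPDE.Torus.Visc4 (Fin 3)} {lo hi Λ β σ C ν₀ K : ℝ}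
    (hc : 0 < c) (hlo : 0 < lo) (hK : 0 < K) (hwin : WindowClause Φ lo hi Λ β)
    (h : SlowVectorClauseNoEx W M hM c Φ lo hi Λ β σ C ν₀ K) : SlowVectorClause W M hM c Φ lo hi Λ β σ C ν₀ K := by
  intro ν hν n 𝔸 hodd hwin' ℓ hℓ hsep p hp hperp T hT
  exact ⟨exists_effective_singleMode hlo hwin hν.1 hc.le hK hodd hwin' hℓ hsep hperp hT,
    h ν hν n 𝔸 hodd hwin' ℓ hℓ hsep p hp hperp T hT⟩

/-- **ADAPTER v20 → registered.**  The proposed statement of `stub_cellLawV` (conclusion ending in `SlowVectorClauseNoEx`) implies the registered one. -/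
theorem cellLawV_of_cellLawVNoEx
    (hV : ∀ k (W : Literature.Analysis.FluidPDE.LatticeShear.LatticeWord k) (c₀ : ℝ), 0 < c₀ →
    Literature.Analysis.FluidPDE.LatticeShear.IsotropicWordGain W c₀ → ScalarLawBlock W c₀ →
    ∃ M : ℝ, ∃ hM : 0 < M, ∃ c > (0:ℝ), ∃ Φ : FluidPDE.Torus.Visc4 (Fin 3) → FluidPDE.Torus.Visc4 (Fin 3),
      ∃ lo > (0:ℝ), ∃ hi : ℝ, lo ≤ 1 ∧ 1 ≤ hi ∧ ∃ Λ > (1:ℝ), ∃ β ≥ (0:ℝ), WindowClause Φ lo hi Λ β ∧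
      ∃ σ > (0:ℝ), ∃ C : ℝ, 0 ≤ C ∧ ∃ ν₀ > (0:ℝ), ∃ K > (0:ℝ), SlowVectorClauseNoEx W M hM c Φ lo hi Λ β σ C ν₀ K) :
    ∀ k (W : Literature.Analysis.FluidPDE.LatticeShear.LatticeWord k) (c₀ : ℝ), 0 < c₀ →
    Literature.Analysis.FluidPDE.LatticeShear.IsotropicWordGain W c₀ → ScalarLawBlock W c₀ →
    ∃ M : ℝ, ∃ hM : 0 < M, ∃ c > (0:ℝ), ∃ Φ : FluidPDE.Torus.Visc4 (Fin 3) → FluidPDE.Torus.Visc4 (Fin 3),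
      ∃ lo > (0:ℝ), ∃ hi : ℝ, lo ≤ 1 ∧ 1 ≤ hi ∧ ∃ Λ > (1:ℝ), ∃ β ≥ (0:ℝ), WindowClause Φ lo hi Λ β ∧
      ∃ σ > (0:ℝ), ∃ C : ℝ, 0 ≤ C ∧ ∃ ν₀ > (0:ℝ), ∃ K > (0:ℝ), SlowVectorClause W M hM c Φ lo hi Λ β σ C ν₀ K := by
  intro k W c₀ hc₀ hG hS
  obtain ⟨M, hM, c, hc, Φ, lo, hlo, hi, hlo1, hhi1, Λ, hΛ, β, hβ, hwin, σ, hσ, C, hC, ν₀, hν₀, K, hK, hV'⟩ := hV k W c₀ hc₀ hG hS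
  exact ⟨M, hM, c, hc, Φ, lo, hlo, hi, hlo1, hhi1, Λ, hΛ, β, hβ, hwin, σ, hσ, C, hC, ν₀, hν₀, K, hK,
    slowVectorClause_of_noEx hc hlo hK hwin hV'⟩

end

end Summit.AnomalousDissipation.AnomalousDissipation.Cruxes.LagrangianRenormalisationStep.CellLawVNoEx
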